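import Literature.AlgebraicGeometry.AbelianSchemes.AbelianLiftOfPolarizedInvertibleRank
import Literature.AlgebraicGeometry.AbelianSchemes.PolarizationNormalize
import HarnessLib

/-!
# Infinitesimal lifting of finitely polarised abelian schemes of invertible degree — the unit hypothesis discharged (O9g)

Topic `AlgebraicGeometry/AbelianSchemes`, namespace `Literature.AlgebraicGeometry.AbelianSchemes.AbelianSchemeOver`.  THEOREMS ONLY (no definition,
no named fact, no instance, no notation, no `sorry`).  Cell `hodgecm-mathlib` (D-0151), sub-desk P6b census (O9) add3 §A14 (ii): the heads of ★ (O9e)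
`AbelianLiftOfPolarizedInvertibleRank` carry the «unit hypothesis» `hD : 𝒫|_{X₀ × {ε_X̂₀}} ≅ 𝒪` of the dual pair `D` (inherited from the ★ (O8d) letter
`exists_abelianLift_of_isUnit_two_of_letter`).  It is DISCHARGED here: replace `D` by the renormalised dual pair ★ `D.normalize = (X̂₀, 𝒫 ⊗ (pr^*M)^∨)`
([MumfordFogartyKirwan1994] Ch. 6 §2 (p. 121); ★ `AbelianSchemeDualPairNormalize`: same `X̂₀`, and `𝒫'|_{X₀ × {ε}} ≅ 𝒪` by ★
`nonempty_unitHatSlice_iso_normalize`), and read the polarisation for `D.normalize` with the SAME `λ` (★ `Polarization.exists_normalize`,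
[MumfordFogartyKirwan1994] Def. 6.3 reads `𝒫` only on geometric slices) — finiteness and the degree of `λ` are properties of `λ` alone.
Result: for `A` Artinian local, `J₀ ≠ ⊤`, `X₀ → Spec (A⧸J₀)` projective abelian of relative dimension `g` with ANY dual pair `D` and a FINITE
polarisation `λ` of degree `d²` ([MumfordFogartyKirwan1994] Def. 7.2 (ii), ★ `Polarization.HasDegree d`) with `2d ∈ A^×`, `X₀` lifts to an abelian
scheme over `Spec A` ([Oort1971] (2.2.1) in the polarised, prime-to-the-residue-characteristic regime).  HC_CM is proved only modulo the printed
citations until rung 0 closes; nothing here is about HC.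

## References
* [Oort1971] F. Oort, *Finite group schemes, local moduli for abelian varieties, and lifting problems*, Compositio Math. 23 (1971), Theorem (2.2.1)
  (p. 273) and pp. 277–280.
* [MumfordFogartyKirwan1994] D. Mumford, J. Fogarty, F. Kirwan, *GIT*, 3rd ed. (1994), Ch. 6 §2 Definition 6.3 (p. 120), §2 (p. 121), Proposition 6.10
  (p. 121); Ch. 7 §2 Definition 7.2 (p. 129).
* [MilneAV2008] J. S. Milne, *Abelian Varieties* (v2.00, 2008), I §8 pp. 36–37.
* [MumfordAV1970] D. Mumford, *Abelian Varieties* (1970), §13 (p. 123), §23 (p. 231).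
-/

set_option autoImplicit false

noncomputable section

universe u

open CategoryTheory CategoryTheory.Limits AlgebraicGeometry
open Literature.AlgebraicGeometry.Motives

namespace Literature.AlgebraicGeometry.AbelianSchemes.AbelianSchemeOver

variable {A : Type} [CommRing A] [IsArtinianRing A] [IsLocalRing A]

/-- **(U) for finitely polarised abelian schemes of invertible degree, NO unit hypothesis**: `A` Artinian local, `J₀ ≠ ⊤`, `X₀ → Spec (A⧸J₀)`
projective abelian of relative dimension `g`, `D` any dual pair, `λ` a finite polarisation with `λ_* 𝒪` locally free of rank `d²` and `2d ∈ A^×` ⇒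
`X₀` lifts to `Spec A` (★ (O9e) `exists_abelianLift_of_polarization_hasDegree_of_isUnit_two_mul` for `D.normalize`, whose unit hypothesis holds, ★
`nonempty_unitHatSlice_iso_normalize`, with the same `λ`, ★ `Polarization.exists_normalize`). [cite: Oort1971, Theorem (2.2.1) (p. 273) and pp. 277–280]
[cite: MumfordFogartyKirwan1994, Ch. 6 §2 (p. 121); Ch. 6 §2 Definition 6.3 (p. 120); Ch. 7 §2 Definition 7.2 (p. 129)] [cite: MilneAV2008, I §8 pp. 36–37] -/
theorem exists_abelianLift_of_polarization_hasDegree (J₀ : Ideal A) (hJ₀ : J₀ ≠ ⊤) {g : ℕ}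
    (X₀ : AbelianSchemeOver (Spec (.of (A ⧸ J₀)))) (hg : X₀.IsOfRelDim g) (hP : Morphisms.IsProjective X₀.X.hom)
    {D : X₀.DualPair} (pol : X₀.Polarization D) [IsFinite pol.lam.left] {d : ℕ} (hdeg : pol.HasDegree d) (h2d : IsUnit ((2 * d : ℕ) : A)) :
    ∃ (X : AbelianSchemeOver (Spec (.of A))) (_ : X.IsOfRelDim g) (G : X₀.X.left ⟶ X.X.left),
      X₀.IsBaseChangeVia X (Spec.map (CommRingCat.ofHom (Ideal.Quotient.mk J₀))) G := by
  obtain ⟨pol', hlam⟩ := pol.exists_normalize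
  haveI : IsFinite pol'.lam.left := by rw [hlam]; exact ‹IsFinite pol.lam.left›
  have hdeg' : pol'.HasDegree d := by rw [Polarization.hasDegree_iff, hlam]; exact (pol.hasDegree_iff d).mp hdeg
  exact exists_abelianLift_of_polarization_hasDegree_of_isUnit_two_mul J₀ hJ₀ X₀ hg hP D.normalize
    D.nonempty_unitHatSlice_iso_normalize pol' hdeg' h2d

/-- **The same in pointwise-rank currency, NO unit hypothesis**: `λ` finite and flat of constant `Scheme.Hom.finrank` `N` with `N ∈ (A⧸J₀)^×` and
`2 ∈ A^×`. [cite: Oort1971, Theorem (2.2.1) (p. 273) and pp. 277–280] [cite: MumfordFogartyKirwan1994, Ch. 6 §2 (p. 121); Ch. 7 §2 Definition 7.2 (p. 129)]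
[cite: MilneAV2008, I §8 pp. 36–37] [cite: MumfordAV1970, §13 (p. 123) and §23 (p. 231)] -/
theorem exists_abelianLift_of_isUnit_two_of_polarization_finrank_eq' (J₀ : Ideal A) (hJ₀ : J₀ ≠ ⊤) {g : ℕ} (h2 : IsUnit (2 : A))
    (X₀ : AbelianSchemeOver (Spec (.of (A ⧸ J₀)))) (hg : X₀.IsOfRelDim g) (hP : Morphisms.IsProjective X₀.X.hom)
    {D : X₀.DualPair} (pol : X₀.Polarization D) [IsFinite pol.lam.left] [Flat pol.lam.left] {N : ℕ} [NeZero N]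
    (hdeg : ∀ y : D.hat.X.left, pol.lam.left.finrank y = N) (hN : IsUnit ((N : ℕ) : A ⧸ J₀)) :
    ∃ (X : AbelianSchemeOver (Spec (.of A))) (_ : X.IsOfRelDim g) (G : X₀.X.left ⟶ X.X.left),
      X₀.IsBaseChangeVia X (Spec.map (CommRingCat.ofHom (Ideal.Quotient.mk J₀))) G := by
  obtain ⟨pol', hlam⟩ := pol.exists_normalize
  haveI : IsFinite pol'.lam.left := by rw [hlam]; exact ‹IsFinite pol.lam.left›
  haveI : Flat pol'.lam.left := by rw [hlam]; exact ‹Flat pol.lam.left›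
  have hdeg' : ∀ y : D.normalize.hat.X.left, pol'.lam.left.finrank y = N := by rw [hlam]; exact hdeg
  exact exists_abelianLift_of_isUnit_two_of_polarization_finrank_eq J₀ hJ₀ h2 X₀ hg hP D.normalize
    D.nonempty_unitHatSlice_iso_normalize pol' hdeg' hN

end Literature.AlgebraicGeometry.AbelianSchemes.AbelianSchemeOver

end
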